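import Literature.NumberTheory.EllipticCurves.Wuthrich2014.RankOneConverseOddPrimeProofs
import Literature.NumberTheory.EllipticCurves.Rank1Residual.X1RankOne
import Literature.NumberTheory.EllipticCurves.Rank1Residual.Typed.X1
import Literature.NumberTheory.EllipticCurves.GreenbergVatsal2000.IwasawaInvariants
import HarnessLib

/-!
# Class X1 (Eisenstein ANOMALOUS good `p`), analytic rank ONE at EVERY prime of the class (`p = 3` included):
# the published record modulo the Schneider certificate; the sub-class B1 (`gvpar`) closed modulo it

HONEST FRAMING (cell `b2b-bsdres`, home `run/shared/lean/b2b/bsd-rank1-residual/`, unit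
`b2b-bsdres-x1b`, prover B, GEN 4, independent patchwork — NO Keller–Yin input): the cell deletes the
COMBINATION-SHAPED residual classes of the rank-`≤ 1` BSD formula STRICTLY from published theorems and
TYPES the remainder; this is not "finishing BSD". ODD-PRIME companion of `Rank1Residual/X1RankOne.lean`
(gen 3), which carried `5 ≤ p` because the tree's canonical-height / Perrin-Riou–Schneider / Perrin-Riou
facts did. Gen 4 supplies the 3-adic vocabulary (`PadicSigmaOddPrime.lean`: THE canonical height datum
exists uniquely at every odd good ordinary prime, from the single fact `mazur_tate_sigma_exists_odd` —
Mazur–Tate 1991 / Mazur–Stein–Tate 2006 Thm. 1.3 / Balakrishnan 2016 (2.3), `hMT` below), the printed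
odd-prime forms of the two analytic facts (`Schneider1985_order_charGenerator_odd` = BMS 2016 Thm. 1.7
at `p > 2`, `hS`; `perrinRiou_rankOne_leadingTerms_odd` = Perrin-Riou 1987 §1.4 at odd `p`, `hPR`) and
the engine at odd `p` (`Wuthrich2014/RankOne{Engine,Converse}OddPrimeProofs`). Since `ClassX1 W p`
contains `2 < p`, the class theorems below carry NO restriction on `p` any more: they hold on all of
X1 ∩ {r_an = 1}.

**What this buys on the census** (prover A's exact parity table `x1_gvtype_classes_j041378.tsv`; a
pointer, not a verdict): X1 ∩ {r_an = 1} has 434 pairs with `N < 10⁴` (754 with `N < 2·10⁴`), of which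
396 (683) are at `p = 3` — 381 (656) of parity type A and 15 (27) of type B. Gen 3 reached only the 38
(71) pairs at `p ≥ 5`. With this file:
* **B1 := X1 ∧ {r = 1} ∧ gvpar is CLOSED modulo the per-curve Schneider certificate at EVERY `p`**
  (`X1.bsdp_of_gvPar_of_analyticRank_eq_one`, canonical shape `X1.bsdp_of_gvPar_odd`): Greenberg–Vatsal
  2000 Thm. 1.3 (printed for odd `p`; tree fact `hGV` with `p ≠ 2`) gives Mazur's main conjecture, and
  main conjecture + Perrin-Riou–Schneider + Perrin-Riou + GZK give `ord_p #Ш_an = ord_p #Ш`. Prover A's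
  route to the 15 (27) type-B pairs at `p = 3` uses the Keller–Yin PREPRINT plus a per-pair twist
  certificate; this route uses NO preprint — its only non-published input is the 3-adic certificate
  `[T¹]L_3(E,T) ≠ 0` (equivalently `Reg_3(E) ≠ 0`, Balakrishnan 2016's 3-adic heights);
* on all of X1 ∩ {r = 1} (type A included), modulo the certificate: `ord_p #Ш ≤ ord_p #Ш_an`
  (`X1.missingUpperBoundAt_of_analyticRank_eq_one`) and Mazur's main conjecture for `(E,p)` ⟺ `BSDp W p`
  ⟺ `Typed.X1.MissingInputAt W p` (`X1.mainConjecture_iff_bsdp_of_analyticRank_eq_one`,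
  `X1.mainConjecture_iff_missingInputAt_of_analyticRank_eq_one`) — prover A's typed input and prover B's
  typed residual are one statement at rank `1` for every `p`, as gen 2 showed at rank `0`;
* per pair with `p ∤ #Ш(E/ℚ)_an` (every rank-one X1 census pair): the certificate ALONE yields `BSD(E,p)`
  AND Mazur's main conjecture at `(E,p)` (`X1.bsdp_and_mainConjecture_of_analyticRank_eq_one_of_shaAn_unit`,
  canonical shape `X1.bsdp_of_shaAn_unit_odd`): the lane's lever for the 396 rank-one X1 rows at `p = 3`
  becomes a 3-adic height / 3-adic `L`-series computation (PARI `ellpadicregulator` / `ellpadicL`,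
  Balakrishnan 2016 §4) instead of a `p`-isogeny descent or the announced Keller–Yin theorem.

The certificate (`hSch`: `∀ Dh, Dh.IsCanonical → SchneiderConjecture Dh`) is Schneider's non-degeneracy
of THE canonical cyclotomic `p`-adic height — a class-level OPEN statement (Schneider 1985), certified
per pair by a finite `p`-adic computation when it holds (`X1.schneider_of_coeff_one_ne_zero_odd`).
Nothing here changes a census verdict; labels are the referee's.

References: [Wuthrich2014] Thm. 16, §6; [PerrinRiou1987] §1.4 Cor. 1.8; [BalakrishnanMullerStein2015]
Thm. 1.7; [Balakrishnan2016] §2, §4; [MazurSteinTate2006] Thm. 1.3; [GreenbergVatsal2000] Thm. (1.3);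
[SteinWuthrich2013] §§3–4, §9; [Miller2011LMS] Def. 1.1.
-/

set_option autoImplicit false

noncomputable section

open scoped Classical MatrixGroups ModularForm

open CongruenceSubgroup WeierstrassCurve Literature.NumberTheory.EllipticCurves
  Literature.NumberTheory.EllipticCurves.ModularForms
  Literature.NumberTheory.EllipticCurves.Wuthrich2014
  Literature.NumberTheory.EllipticCurves.Rank1Residual.Typed

namespace Literature.NumberTheory.EllipticCurves.Rank1Residual

/-! ### The parity sub-class (GV): main conjecture in print ⟹ `BSD(E,p)` modulo the certificate -/

/-- **Rank one under the Greenberg–Vatsal parity condition: `BSD(E,p)` modulo the Schneider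
certificate, odd `p`.** For `W/ℚ` globally minimal elliptic, `p ≠ 2` good ordinary with `GVPar W p` (some
rational `p`-isogeny kernel ramified-even or unramified-odd — in particular `E[p]` reducible),
`ord_{s=1} L(E,s) = 1`, and Schneider's non-degeneracy for the canonical `p`-adic height (`hSch`):
Miller's `BSDp W p`. Chain: Greenberg–Vatsal 2000 Thm. 1.3 (+ Kato) gives Mazur's main conjecture for
`(E,p)` (`hGV`, no rank hypothesis, `p` odd); `missingPPartAt_of_mainConjecture_of_rank_one_odd`
(Perrin-Riou–Schneider `hS`, Perrin-Riou 1987 `hPR`, Mazur–Tate sigma `hMT`, modularity `hmod`, GZK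
`hGZK`) gives `ord_p #Ш_an = ord_p #Ш`; Miller's
remaining clauses are GZK. No Wuthrich and no Keller–Yin input. [cite: GreenbergVatsal2000, Thm. (1.3)]
[cite: PerrinRiou1987, §1.4 Cor. 1.8] [cite: BalakrishnanMullerStein2015, Thm. 1.7]
[cite: Miller2011LMS, Def. 1.1 (arXiv:1010.2431 p. 3)] -/
theorem bsdp_of_gvPar_of_analyticRank_eq_one_odd (hGV : GreenbergVatsal2000.thm13_charIdeal_eq_of_gvPar)
    (hS : Schneider1985_order_charGenerator_odd) (hPR : perrinRiou_rankOne_leadingTerms_odd)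
    (hMT : mazur_tate_sigma_exists_odd)
    (hmod : nonempty_modularParametrizationData)
    (hGZK : rank_eq_analyticRank_of_analyticRank_le_one)
    (W : WeierstrassCurve ℚ) [W.IsElliptic] [W.IsGloballyMinimal] (p : ℕ) [Fact p.Prime]
    (hp : p ≠ 2) (hgood : W.HasGoodReductionAtPrime p) (hordp : ¬ (p : ℤ) ∣ W.frobeniusTrace p)
    (hpar : GVPar W p) (han : W.analyticRank = 1)
    (hSch : ∀ Dh : PAdicHeightData W p, Dh.IsCanonical → SchneiderConjecture Dh) : BSDp W p :=
  bsdp_of_missingPPartAt W p hGZK han.le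
    (missingPPartAt_of_mainConjecture_of_rank_one_odd hS hPR hMT hmod hGZK W p hp hgood hordp han hSch
      (hGV W p hp hgood hordp hpar))

/-! ### Class X1, analytic rank one, every `p` of the class -/

/-- **X1 ∩ {r = 1}, any `p` of the class (`2 < p` is a class clause): the published half
`ord_p #Ш(E/ℚ) ≤ ord_p #Ш(E/ℚ)_an`** modulo the Schneider certificate (Wuthrich Thm. 16 +
Perrin-Riou–Schneider + Perrin-Riou + Mazur–Tate sigma + modularity + GZK;
`Wuthrich2014.missingUpperBoundAt_of_rank_one_odd` on the class: odd, good, ordinary since anomalous,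
reducible). [cite: Balakrishnan2016, §2]
[cite: Wuthrich2014, Thm. 16 (p. 393) and §6 (p. 400)] [cite: PerrinRiou1987, §1.4 Cor. 1.8] -/
theorem X1.missingUpperBoundAt_of_analyticRank_eq_one (hW16 : charIdeal_dvd_padicLFunction)
    (hS : Schneider1985_order_charGenerator_odd) (hPR : perrinRiou_rankOne_leadingTerms_odd)
    (hMT : mazur_tate_sigma_exists_odd)
    (hmod : nonempty_modularParametrizationData)
    (hGZK : rank_eq_analyticRank_of_analyticRank_le_one)
    (W : WeierstrassCurve ℚ) [W.IsElliptic] [W.IsGloballyMinimal] (p : ℕ) [Fact p.Prime]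
    (hX1 : ClassX1 W p) (han : W.analyticRank = 1)
    (hSch : ∀ Dh : PAdicHeightData W p, Dh.IsCanonical → SchneiderConjecture Dh) :
    MissingUpperBoundAt W p :=
  have hX := isClassX1_of_classX1 hX1
  Wuthrich2014.missingUpperBoundAt_of_rank_one_odd hW16 hS hPR hMT hmod hGZK W p hX1.1.ne'
    hX.hasGoodReductionAtPrime hX.not_dvd_frobeniusTrace hX.not_hasIrreducibleModPGaloisRep han hSch

/-- **X1 ∩ {r = 1}, any `p` of the class: Mazur's main conjecture for `(E,p)` ⟺ Miller's `BSD(E,p)`**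
modulo the Schneider certificate, granted Wuthrich Thm. 16, Perrin-Riou–Schneider, Perrin-Riou 1987,
Mazur–Tate sigma, modularity and GZK — gen 2's rank-`0` identification (`X1.mainConjecture_iff_bsdp`)
carried to rank `1` at every prime (gen 3: `p ≥ 5`). The left side is literally the body of prover
A's `MazurMainConjecture W p`. [cite: Balakrishnan2016, §2] [cite: Wuthrich2014, Thm. 16 and §6]
[cite: PerrinRiou1987, §1.4 Cor. 1.8] [cite: BalakrishnanMullerStein2015, Thm. 1.7] -/
theorem X1.mainConjecture_iff_bsdp_of_analyticRank_eq_one (hW16 : charIdeal_dvd_padicLFunction)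
    (hS : Schneider1985_order_charGenerator_odd) (hPR : perrinRiou_rankOne_leadingTerms_odd)
    (hMT : mazur_tate_sigma_exists_odd)
    (hmod : nonempty_modularParametrizationData)
    (hGZK : rank_eq_analyticRank_of_analyticRank_le_one)
    (W : WeierstrassCurve ℚ) [W.IsElliptic] [W.IsGloballyMinimal] (p : ℕ) [Fact p.Prime]
    (hX1 : ClassX1 W p) (han : W.analyticRank = 1)
    (hSch : ∀ Dh : PAdicHeightData W p, Dh.IsCanonical → SchneiderConjecture Dh) :
    (∀ (κ : ZpExtension ℚ p) (γ : Field.absoluteGaloisGroup ℚ),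
        κ.IsCyclotomic → κ.IsTopGenerator γ → IsCyclotomicVariable p γ →
      ∀ [NeZero (W.conductorNorm ℤ)] (f : CuspForm (Gamma0 (W.conductorNorm ℤ)) 2),
        IsNewformOf W f → ∀ (ϖ : ℚ), (ϖ : ℝ) * W.realPeriodRat = plusPeriod f →
      ∀ (D : W.SelmerDualData κ γ), D.IsTorsion ∧
        ∃ g : IwasawaAlgebra p, D.charIdeal = Ideal.span {g} ∧
          iwasawaToPowerSeries p g =
            PowerSeries.C (ϖ : ℚ_[p]) * padicLFunction f (unitRoot W p : ℚ_[p])) ↔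
    BSDp W p :=
  have hX := isClassX1_of_classX1 hX1
  Wuthrich2014.mainConjecture_iff_bsdp_of_rank_one_odd hW16 hS hPR hMT hmod hGZK W p hX1.1.ne'
    hX.hasGoodReductionAtPrime hX.not_dvd_frobeniusTrace hX.not_hasIrreducibleModPGaloisRep han hSch

/-- **X1 ∩ {r = 1}, any `p` of the class: prover A's typed input ⟺ prover B's typed residual**, modulo
the Schneider
certificate: Mazur's main conjecture for `(E,p)` holds iff `Typed.X1.MissingInputAt W p` (whose rank-one
clause is `MissingPPartAt W p`; the rank-zero clause is vacuous here). Same facts.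
[cite: Wuthrich2014, Thm. 16 and §6] [cite: PerrinRiou1987, §1.4 Cor. 1.8] -/
theorem X1.mainConjecture_iff_missingInputAt_of_analyticRank_eq_one (hW16 : charIdeal_dvd_padicLFunction)
    (hS : Schneider1985_order_charGenerator_odd) (hPR : perrinRiou_rankOne_leadingTerms_odd)
    (hMT : mazur_tate_sigma_exists_odd)
    (hmod : nonempty_modularParametrizationData)
    (hGZK : rank_eq_analyticRank_of_analyticRank_le_one)
    (W : WeierstrassCurve ℚ) [W.IsElliptic] [W.IsGloballyMinimal] (p : ℕ) [Fact p.Prime]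
    (hX1 : ClassX1 W p) (han : W.analyticRank = 1)
    (hSch : ∀ Dh : PAdicHeightData W p, Dh.IsCanonical → SchneiderConjecture Dh) :
    (∀ (κ : ZpExtension ℚ p) (γ : Field.absoluteGaloisGroup ℚ),
        κ.IsCyclotomic → κ.IsTopGenerator γ → IsCyclotomicVariable p γ →
      ∀ [NeZero (W.conductorNorm ℤ)] (f : CuspForm (Gamma0 (W.conductorNorm ℤ)) 2),
        IsNewformOf W f → ∀ (ϖ : ℚ), (ϖ : ℝ) * W.realPeriodRat = plusPeriod f →
      ∀ (D : W.SelmerDualData κ γ), D.IsTorsion ∧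
        ∃ g : IwasawaAlgebra p, D.charIdeal = Ideal.span {g} ∧
          iwasawaToPowerSeries p g =
            PowerSeries.C (ϖ : ℚ_[p]) * padicLFunction f (unitRoot W p : ℚ_[p])) ↔
    X1.MissingInputAt W p := by
  have hX := isClassX1_of_classX1 hX1
  rw [Wuthrich2014.mainConjecture_iff_missingPPartAt_of_rank_one_odd hW16 hS hPR hMT hmod hGZK W p hX1.1.ne'
    hX.hasGoodReductionAtPrime hX.not_dvd_frobeniusTrace hX.not_hasIrreducibleModPGaloisRep han hSch]
  constructor
  · intro h
    exact ⟨fun h0 ↦ absurd (h0.symm.trans han) zero_ne_one, fun _ ↦ h⟩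
  · intro h
    exact h.2 han

/-- **B1 := X1 ∧ {r = 1} ∧ gvpar is closed at EVERY `p` modulo the Schneider certificate** (no
Keller–Yin, no partner main conjecture, no twist certificate): `ClassX1 W p`, `ord_{s=1} L(E,s) = 1`,
`GVPar W p` and the certificate give `BSDp W p`, from Greenberg–Vatsal 2000 Thm. 1.3 (`hGV`),
Perrin-Riou–Schneider (`hS`), Perrin-Riou 1987 (`hPR`), Mazur–Tate sigma (`hMT`), modularity (`hmod`),
GZK (`hGZK`) — all PUBLISHED. Census members at `p = 3` (prover A's table): 15 pairs with `N < 10⁴`,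
27 with `N < 2·10⁴`; with gen 3's 5/10 at `p ≥ 5`, B1 has 20/37 census pairs, all now covered.
[cite: Balakrishnan2016, §2]
(`bsdp_of_gvPar_of_analyticRank_eq_one_odd`; on X1 good and ordinary are class clauses.)
[cite: GreenbergVatsal2000, Thm. (1.3)] [cite: PerrinRiou1987, §1.4 Cor. 1.8]
[cite: BalakrishnanMullerStein2015, Thm. 1.7] [cite: Miller2011LMS, Def. 1.1 (arXiv:1010.2431 p. 3)] -/
theorem X1.bsdp_of_gvPar_of_analyticRank_eq_one (hGV : GreenbergVatsal2000.thm13_charIdeal_eq_of_gvPar)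
    (hS : Schneider1985_order_charGenerator_odd) (hPR : perrinRiou_rankOne_leadingTerms_odd)
    (hMT : mazur_tate_sigma_exists_odd)
    (hmod : nonempty_modularParametrizationData)
    (hGZK : rank_eq_analyticRank_of_analyticRank_le_one)
    (W : WeierstrassCurve ℚ) [W.IsElliptic] [W.IsGloballyMinimal] (p : ℕ) [Fact p.Prime]
    (hX1 : ClassX1 W p) (han : W.analyticRank = 1) (hpar : GVPar W p)
    (hSch : ∀ Dh : PAdicHeightData W p, Dh.IsCanonical → SchneiderConjecture Dh) : BSDp W p :=
  have hX := isClassX1_of_classX1 hX1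
  bsdp_of_gvPar_of_analyticRank_eq_one_odd hGV hS hPR hMT hmod hGZK W p hX1.1.ne' hX.hasGoodReductionAtPrime
    hX.not_dvd_frobeniusTrace hpar han hSch

/-- **On B1 (any `p`) the typed residual `X1.MissingInputAt` is inhabited modulo the certificate** (from
`X1.bsdp_of_gvPar_of_analyticRank_eq_one` and `missingPPartAt_of_bsdp`; `Ш` finite by GZK).
[cite: GreenbergVatsal2000, Thm. (1.3)] [cite: PerrinRiou1987, §1.4 Cor. 1.8] -/
theorem X1.missingInputAt_of_gvPar_of_analyticRank_eq_one (hGV : GreenbergVatsal2000.thm13_charIdeal_eq_of_gvPar)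
    (hS : Schneider1985_order_charGenerator_odd) (hPR : perrinRiou_rankOne_leadingTerms_odd)
    (hMT : mazur_tate_sigma_exists_odd)
    (hmod : nonempty_modularParametrizationData)
    (hGZK : rank_eq_analyticRank_of_analyticRank_le_one)
    (W : WeierstrassCurve ℚ) [W.IsElliptic] [W.IsGloballyMinimal] (p : ℕ) [Fact p.Prime]
    (hX1 : ClassX1 W p) (han : W.analyticRank = 1) (hpar : GVPar W p)
    (hSch : ∀ Dh : PAdicHeightData W p, Dh.IsCanonical → SchneiderConjecture Dh) :
    X1.MissingInputAt W p := by
  haveI : Finite W.sha := (hGZK W han.le).2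
  exact ⟨fun h0 ↦ absurd (h0.symm.trans han) zero_ne_one, fun _ ↦ missingPPartAt_of_bsdp W p
    (X1.bsdp_of_gvPar_of_analyticRank_eq_one hGV hS hPR hMT hmod hGZK W p hX1 han hpar hSch)⟩

/-- **X1 ∩ {r = 1}, any `p` of the class, `p ∤ #Ш(E/ℚ)_an`: the certificate yields `BSD(E,p)` AND
Mazur's main conjecture for `(E,p)`** (Wuthrich Thm. 16 + Perrin-Riou–Schneider + Perrin-Riou +
Mazur–Tate sigma + modularity + GZK; `Wuthrich2014.bsdp_and_mainConjecture_of_rank_one_of_shaAn_unit_odd`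
on the class). Every rank-one X1 census pair (`N < 10⁴`: 434, of which 396 at `p = 3`) has `p ∤ #Ш_an`;
the per-curve lever is the `p`-adic computation `[T¹]L_p(E,T) ≠ 0` (lane pointer, not a verdict).
[cite: Balakrishnan2016, §2 and §4]
[cite: Wuthrich2014, Thm. 16 and §6] [cite: PerrinRiou1987, §1.4 Cor. 1.8]
[cite: Miller2011LMS, Def. 1.1 (arXiv:1010.2431 p. 3)] -/
theorem X1.bsdp_and_mainConjecture_of_analyticRank_eq_one_of_shaAn_unit (hW16 : charIdeal_dvd_padicLFunction)
    (hS : Schneider1985_order_charGenerator_odd) (hPR : perrinRiou_rankOne_leadingTerms_odd)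
    (hMT : mazur_tate_sigma_exists_odd)
    (hmod : nonempty_modularParametrizationData)
    (hGZK : rank_eq_analyticRank_of_analyticRank_le_one)
    (W : WeierstrassCurve ℚ) [W.IsElliptic] [W.IsGloballyMinimal] (p : ℕ) [Fact p.Prime]
    (hX1 : ClassX1 W p) (han : W.analyticRank = 1)
    (hSch : ∀ Dh : PAdicHeightData W p, Dh.IsCanonical → SchneiderConjecture Dh)
    (hunit : ∃ q : ℚ, shaAn W = (q : ℂ) ∧ padicValRat p q = 0) :
    BSDp W p ∧
    (∀ (κ : ZpExtension ℚ p) (γ : Field.absoluteGaloisGroup ℚ),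
        κ.IsCyclotomic → κ.IsTopGenerator γ → IsCyclotomicVariable p γ →
      ∀ [NeZero (W.conductorNorm ℤ)] (f : CuspForm (Gamma0 (W.conductorNorm ℤ)) 2),
        IsNewformOf W f → ∀ (ϖ : ℚ), (ϖ : ℝ) * W.realPeriodRat = plusPeriod f →
      ∀ (D : W.SelmerDualData κ γ), D.IsTorsion ∧
        ∃ g : IwasawaAlgebra p, D.charIdeal = Ideal.span {g} ∧
          iwasawaToPowerSeries p g =
            PowerSeries.C (ϖ : ℚ_[p]) * padicLFunction f (unitRoot W p : ℚ_[p])) :=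
  have hX := isClassX1_of_classX1 hX1
  Wuthrich2014.bsdp_and_mainConjecture_of_rank_one_of_shaAn_unit_odd hW16 hS hPR hMT hmod hGZK W p hX1.1.ne'
    hX.hasGoodReductionAtPrime hX.not_dvd_frobeniusTrace hX.not_hasIrreducibleModPGaloisRep han hSch hunit

/-- **The certificate in the form the lane computes it (odd `p`).** At an X1 pair with
`ord_{s=1} L(E,s) = 1`: if `[T¹]L_p(f,α,T) ≠ 0` for SOME newform `f` of `E` (a `p`-adic `L`-series
computation to finite precision), then Schneider's non-degeneracy holds for the canonical height
(`coeff_one_padicLFunction_ne_zero_iff_schneider_odd`; Perrin-Riou `hPR`, GZK `hGZK`).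
[cite: PerrinRiou1987, §1.4 Cor. 1.8] [cite: SteinWuthrich2013, §§3–4] -/
theorem X1.schneider_of_coeff_one_ne_zero_odd (hPR : perrinRiou_rankOne_leadingTerms_odd)
    (hGZK : rank_eq_analyticRank_of_analyticRank_le_one)
    (W : WeierstrassCurve ℚ) [W.IsElliptic] [W.IsGloballyMinimal] (p : ℕ) [Fact p.Prime]
    (hX1 : ClassX1 W p) (han : W.analyticRank = 1) {N : ℕ} [NeZero N]
    (f : CuspForm (Gamma0 N) 2) (hf : IsNewformOf W f)
    (hcoeff : PowerSeries.coeff 1 (padicLFunction f (unitRoot W p : ℚ_[p])) ≠ 0) :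
    ∀ Dh : PAdicHeightData W p, Dh.IsCanonical → SchneiderConjecture Dh := by
  have hX := isClassX1_of_classX1 hX1
  intro Dh hDh
  exact (coeff_one_padicLFunction_ne_zero_iff_schneider_odd hPR hGZK W p hX1.1.ne'
    ⟨hX.hasGoodReductionAtPrime, hX.not_dvd_frobeniusTrace⟩ han Dh hDh f hf).mp hcoeff

/-! ### Canonical shape: `analyticRank ≤ 1 → ClassX1 W p → …` -/

/-- **B1 in the canonical shape of the cell, every `p`.** For every globally minimal elliptic `W/ℚ` and
prime `p` with `ord_{s=1} L(E,s) ≤ 1`, `ClassX1 W p` and `GVPar W p`: the class clause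
`¬(r_an = 0 ∧ gvpar)` forces `r_an = 1`, so `X1.bsdp_of_gvPar_of_analyticRank_eq_one` gives Miller's `BSDp W p`
modulo the Schneider certificate (`hSch`), from Greenberg–Vatsal 2000 Thm. 1.3 (`hGV`),
Perrin-Riou–Schneider (`hS`), Perrin-Riou 1987 (`hPR`), Mazur–Tate sigma (`hMT`), modularity (`hmod`),
GZK (`hGZK`) — all PUBLISHED; no Keller–Yin input. [cite: GreenbergVatsal2000, Thm. (1.3)] [cite: PerrinRiou1987, §1.4 Cor. 1.8]
[cite: BalakrishnanMullerStein2015, Thm. 1.7] [cite: Miller2011LMS, Def. 1.1 (arXiv:1010.2431 p. 3)] -/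
theorem X1.bsdp_of_gvPar_odd (hGV : GreenbergVatsal2000.thm13_charIdeal_eq_of_gvPar)
    (hS : Schneider1985_order_charGenerator_odd) (hPR : perrinRiou_rankOne_leadingTerms_odd)
    (hMT : mazur_tate_sigma_exists_odd)
    (hmod : nonempty_modularParametrizationData)
    (hGZK : rank_eq_analyticRank_of_analyticRank_le_one)
    (W : WeierstrassCurve ℚ) [W.IsElliptic] [W.IsGloballyMinimal] (p : ℕ) [Fact p.Prime]
    (hr : W.analyticRank ≤ 1) (hX1 : ClassX1 W p) (hpar : GVPar W p)
    (hSch : ∀ Dh : PAdicHeightData W p, Dh.IsCanonical → SchneiderConjecture Dh) : BSDp W p := by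
  have han : W.analyticRank = 1 := by
    rcases Nat.le_one_iff_eq_zero_or_eq_one.mp hr with h0 | h1
    · exact absurd ⟨h0, hpar⟩ hX1.2.2.2.2
    · exact h1
  exact X1.bsdp_of_gvPar_of_analyticRank_eq_one hGV hS hPR hMT hmod hGZK W p hX1 han hpar hSch

/-- **Canonical shape, both ranks, every `p`, `p ∤ #Ш(E/ℚ)_an`:** for every globally minimal elliptic
`W/ℚ` and prime `p` with `ord_{s=1} L(E,s) ≤ 1`, `ClassX1 W p` and `#Ш(E/ℚ)_an` a rational of
`p`-adic valuation `0`: `BSDp W p`, where in analytic rank `0` nothing more is needed (Wuthrich 2014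
Prop. 21 `hW`, gen 1: `bsdp_of_classX1_of_L_one_ne_zero`) and in analytic rank `1` the Schneider
certificate is (`hSch`, used only when `r_an = 1`;
`X1.bsdp_and_mainConjecture_of_analyticRank_eq_one_of_shaAn_unit` — Wuthrich Thm. 16 `hW16`,
Perrin-Riou–Schneider `hS`, Perrin-Riou `hPR`, Mazur–Tate sigma `hMT`, modularity `hmod`, GZK `hGZK`).
On the census every X1 pair has `p ∤ #Ш_an`; this is the one statement behind the lane levers "T-WU14"
(r = 0) and "p-adic certificate" (r = 1, now every p). [cite: Balakrishnan2016, §2] [cite: Wuthrich2014, Thm. 16, §6 and Prop. 21]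
[cite: PerrinRiou1987, §1.4 Cor. 1.8] [cite: Miller2011LMS, Def. 1.1 (arXiv:1010.2431 p. 3)] -/
theorem X1.bsdp_of_shaAn_unit_odd (hW : sha_dvd_analyticSha) (hW16 : charIdeal_dvd_padicLFunction)
    (hS : Schneider1985_order_charGenerator_odd) (hPR : perrinRiou_rankOne_leadingTerms_odd)
    (hMT : mazur_tate_sigma_exists_odd)
    (hmod : nonempty_modularParametrizationData)
    (hGZK : rank_eq_analyticRank_of_analyticRank_le_one)
    (W : WeierstrassCurve ℚ) [W.IsElliptic] [W.IsGloballyMinimal] (p : ℕ) [Fact p.Prime]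
    (hr : W.analyticRank ≤ 1) (hX1 : ClassX1 W p)
    (hunit : ∃ q : ℚ, shaAn W = (q : ℂ) ∧ padicValRat p q = 0)
    (hSch : W.analyticRank = 1 → ∀ Dh : PAdicHeightData W p, Dh.IsCanonical → SchneiderConjecture Dh) :
    BSDp W p := by
  rcases Nat.le_one_iff_eq_zero_or_eq_one.mp hr with h0 | h1
  · haveI : NeZero (W.conductorNorm ℤ) := ⟨(W.conductorNorm_pos_holds).ne'⟩
    obtain ⟨Dm⟩ := hmod W
    exact bsdp_of_classX1_of_L_one_ne_zero hW hGZK W p hr hX1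
      ((W.analyticRank_eq_zero_iff_holds Dm.isNewformOf.hasEntireLFunction).mp h0) hunit
  · exact (X1.bsdp_and_mainConjecture_of_analyticRank_eq_one_of_shaAn_unit hW16 hS hPR hMT hmod hGZK W p hX1 h1
      (hSch h1) hunit).1

/-! ### Appended (gen 4): type A — the typed input `MC(E,p)` gives the target with NO Wuthrich input -/

/-- **X1 ∩ {r = 1}, every `p`: Mazur's main conjecture for `(E,p)` ⟹ Miller's `BSD(E,p)`, modulo the
Schneider certificate, WITHOUT Wuthrich's Thm. 16** — the direction prover A's typed input is used in:
main conjecture (`hMC`, body of `MazurMainConjecture W p`) + Perrin-Riou–Schneider (`hS`) + Perrin-Riou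
1987 (`hPR`) + Mazur–Tate sigma (`hMT`) + modularity (`hmod`) + GZK (`hGZK`) ⟹ `ord_p #Ш_an = ord_p #Ш`
(`Wuthrich2014.missingPPartAt_of_mainConjecture_of_rank_one_odd`) ⟹ `BSDp W p`
(`Typed.bsdp_of_missingPPartAt`). For type B `hMC` is Greenberg–Vatsal's theorem
(`X1.bsdp_of_gvPar_of_analyticRank_eq_one`); for type A it is the typed residue
`MazurMainConjectureOnX1TypeA` at `(E,p)`. [cite: PerrinRiou1987, §1.4 Cor. 1.8]
[cite: BalakrishnanMullerStein2015, Thm. 1.7] [cite: Balakrishnan2016, §2]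
[cite: Miller2011LMS, Def. 1.1 (arXiv:1010.2431 p. 3)] -/
theorem X1.bsdp_of_mainConjecture_of_analyticRank_eq_one (hS : Schneider1985_order_charGenerator_odd)
    (hPR : perrinRiou_rankOne_leadingTerms_odd) (hMT : mazur_tate_sigma_exists_odd)
    (hmod : nonempty_modularParametrizationData)
    (hGZK : rank_eq_analyticRank_of_analyticRank_le_one)
    (W : WeierstrassCurve ℚ) [W.IsElliptic] [W.IsGloballyMinimal] (p : ℕ) [Fact p.Prime]
    (hX1 : ClassX1 W p) (han : W.analyticRank = 1)
    (hSch : ∀ Dh : PAdicHeightData W p, Dh.IsCanonical → SchneiderConjecture Dh)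
    (hMC : ∀ (κ : ZpExtension ℚ p) (γ : Field.absoluteGaloisGroup ℚ),
        κ.IsCyclotomic → κ.IsTopGenerator γ → IsCyclotomicVariable p γ →
      ∀ [NeZero (W.conductorNorm ℤ)] (f : CuspForm (Gamma0 (W.conductorNorm ℤ)) 2),
        IsNewformOf W f → ∀ (ϖ : ℚ), (ϖ : ℝ) * W.realPeriodRat = plusPeriod f →
      ∀ (D : W.SelmerDualData κ γ), D.IsTorsion ∧
        ∃ g : IwasawaAlgebra p, D.charIdeal = Ideal.span {g} ∧
          iwasawaToPowerSeries p g =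
            PowerSeries.C (ϖ : ℚ_[p]) * padicLFunction f (unitRoot W p : ℚ_[p])) : BSDp W p :=
  have hX := isClassX1_of_classX1 hX1
  bsdp_of_missingPPartAt W p hGZK han.le
    (Wuthrich2014.missingPPartAt_of_mainConjecture_of_rank_one_odd hS hPR hMT hmod hGZK W p hX1.1.ne'
      hX.hasGoodReductionAtPrime hX.not_dvd_frobeniusTrace han hSch hMC)

end Literature.NumberTheory.EllipticCurves.Rank1Residual

end
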